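import Summits.BirchSwinnertonDyer.BirchSwinnertonDyer.Theorems.GenusKolyvaginAtTwoGenusPrimitiveSupplyAtTwoTwistNormDescent
import Summits.BirchSwinnertonDyer.BirchSwinnertonDyer.Theorems.GenusKolyvaginAtTwoGenusPrimitiveSupplyAtTwoTwistDyadicUnramifiedSqrt
import Literature.NumberTheory.EllipticCurves.KramerTunnell1982.GoodReductionUnramifiedNormIndexProofs
import Literature.NumberTheory.EllipticCurves.QuadraticBaseChangeGaloisProofs
import Literature.NumberTheory.EllipticCurves.RootNumberProofs
import Summits.BirchSwinnertonDyer.BirchSwinnertonDyer.Theorems.GenusKolyvaginAtTwoGenusPrimitiveSupplyAtTwoTwistLemma211Transverse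
import Literature.NumberTheory.GaloisRepresentations.GaloisRepUnramifiedProofs
import HarnessLib

/-!
# Route `GenusKolyvaginAtTwo`, crux #2 `GenusPrimitiveSupplyAtTwo` (stmt-BirchSwinnertonDyer-22136):
# MAZUR–RUBIN LEMMA 2.10 (v) AT EVERY FINITE PLACE, `v ∣ 2` INCLUDED — good reduction + `K_v(√d)/K_v` unramified
# ⟹ the transported local Kummer conditions of `(E, E^{(d)})` AGREE (Mazur's norm theorem, via Kramer–Tunnell Lemma 6.1 type I₀)

Width seat `bsd-line-gk2-p5` g11 (cell `bsd-f1-sign2`, SUPPLY lineage), file 38 of the series (sequel of `…TwistNormDescent.lean`).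
THEOREMS ONLY (no definition, no named fact, no `sorry`, no local instance); helper `--supports stmt-BirchSwinnertonDyer-22136`;
no item is closed; BSD is not proved by any of this.

WHAT (memo `Lines/genus-supply-mr-instantiation.md` §8b (a), (d) and the assembly). Mazur–Rubin 2010, Lemma 2.10 (v): «if `v` is a
prime where `E` has good reduction and `v` is unramified in `F/K`, then `H¹_f(K_v, E[2]) = H¹_f(K_v, E^F[2])`», proved in print from
Lemma 2.9 (`H¹_f ∩ H¹_f^F = E_N(K_v)/2E(K_v)`) and Mazur's norm theorem `E_N(K_v) = E(K_v)` [Maz72, Cor. 4.4]. For `v ∤ 2` the row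
is already the lead's Tamagawa row (`GenusKolyTwistTamagawa.transport_kummer_inr_eq_of_not_dvd_localTamagawaNumber`); the new reach is
`v ∣ 2`, `d ≡ 5 (mod 8)` (2 INERT), the one row of `MazurRubin2010.d2_eq_of_lemma210_rat` the lead's g9 memo §3 recorded as «not
dischargeable». Assembly, at `E = K_v` for ANY finite place of ANY number field:

* §89 THE `𝒪_v`-DICTIONARY: `mem_range_algebraMap_valuationInteger_iff` (`𝒪[K_v]` of the `ValuativeRel` structure has the
  elements of `v.adicCompletionIntegers K`), `exists_integer_model_of_hasGoodReductionAt` (good reduction at `v` ⟹ a model over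
  `𝒪[K_v]` with unit discriminant, `K_v`-isomorphic to `W`), **`fixedSubgroup_le_normSubgroup_of_hasGoodReductionAt`**
  (`[E(K')^σ : N E(K')] = 1` for the unramified quadratic `K' ⊆ K̄_v`: Kramer–Tunnell `relIndex_normSubgroup_fixedSubgroup_eq_one_of_isUnit_Δ`
  + model invariance `Kramer1981.relIndex_norm_fixed_smul`);
* §90 THE FIELD `K' = K_v(ι√d)`: `finrank_adjoin_closureEmb_geomSqrt_eq_two` (`d ∉ K_v²`), `adjoin_closureEmb_geomSqrt_le_maxUnramified`,
  `exists_flip_closureEmb_geomSqrt` (`τ₀ ∈ Γ_{K_v}` with `τ₀ ι√d = −ι√d`), and **`forall_exists_norm_of_hasGoodReductionAt_of_mem_maxUnramified`**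
  — the engine's `hnorm` at `K_v`, from §89 through file 37's `forall_exists_norm_of_fixedSubgroup_le_normSubgroup`;
* (sequel file `…TwistUnramifiedGoodRow.lean`, §91: the engine application `φ_* 𝓛_v(Wd) = 𝓛_v(W)` = LEMMA 2.10 (v) at every
  finite place, and the `φ`-packaged form with Lemma 2.10 (i).)

References: [MazurRubin2010] Lemma 2.9, Lemma 2.10 (v) and its proof (arXiv:0904.3709 p. 7); [Mazur1972] Cor. 4.4; [KramerTunnell1982]
§6 Lemma 6.1 (type I₀); [Kramer1981] Prop. 7; [SilvermanAEC2009] VII.1 Prop. 1.3, VII.5 Prop. 5.1, VIII.§1.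
-/

set_option linter.dupNamespace false -- tree convention: `Summit.BirchSwinnertonDyer.BirchSwinnertonDyer.Theorems` (summit = sub-problem)
set_option autoImplicit false

noncomputable section

open scoped Classical ContRepresentation ValuativeRel

namespace Summit.BirchSwinnertonDyer.BirchSwinnertonDyer.Theorems.GenusKolyArch

open WeierstrassCurve Field NumberField IsDedekindDomain Function Polynomial
open Literature.NumberTheory.EllipticCurves Literature.NumberTheory.GaloisRepresentations
open Literature.NumberTheory.GaloisRepresentations.IsNonarchimedeanLocalField (maxUnramified)
open Literature.NumberTheory.EllipticCurves.KramerTunnell1982 (normSubgroup fixedSubgroup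
  relIndex_normSubgroup_fixedSubgroup_eq_one_of_isUnit_Δ)
open Literature.NumberTheory.GaloisCohomology
open Summit.BirchSwinnertonDyer.Rank1Residual.X11b
open Summit.BirchSwinnertonDyer.Rank1Residual.X11b.CongruentTransfer
open Summit.BirchSwinnertonDyer.BirchSwinnertonDyer.Theorems.GenusKolyTwistLocal (exists_addEquiv_geomTorsion_two_localSquare_signed
  smul_closureEmb_geomSqrt_eq)

/-! ## §89 The `𝒪_v`-dictionary and `[E(K')^σ : N E(K')] = 1` for good reduction -/

section GoodNorm

variable {K : Type} [Field K] [NumberField K] (W : WeierstrassCurve K) (v : HeightOneSpectrum (𝓞 K))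

omit W in
/-- **`𝒪[K_v]` (valuation ring of the `ValuativeRel` structure of the local field `K_v`) has the elements of
`v.adicCompletionIntegers K`** — in the «range of `algebraMap`» form consumed by the tree's transport lemmas
(`isMinimal_map_iff`, `hasGoodReduction_map_iff`): both are the closed unit ball (`adicCompletion_valuation_le_one_iff`). [folklore] -/
theorem mem_range_algebraMap_valuationInteger_iff (x : v.adicCompletion K) :
    (RingEquiv.refl (v.adicCompletion K)) x ∈ (algebraMap 𝒪[v.adicCompletion K] (v.adicCompletion K)).range ↔
      x ∈ (algebraMap (v.adicCompletionIntegers K) (v.adicCompletion K)).range := by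
  rw [RingEquiv.refl_apply, mem_range_algebraMap_adicCompletionIntegers_iff, SetLike.mem_coe,
    HeightOneSpectrum.mem_adicCompletionIntegers, ← Valued.toNormedField.norm_le_one_iff,
    ← adicCompletion_valuation_le_one_iff K v x, ← Valuation.mem_integer_iff]
  constructor
  · rintro ⟨z, rfl⟩
    exact z.2
  · intro h
    exact ⟨⟨x, h⟩, rfl⟩

/-- **Good reduction at `v` ⟹ a Weierstrass model over `𝒪[K_v]` with UNIT discriminant, `K_v`-isomorphic to `W`**: the integral
model of the chosen local minimal model, transported from `v.adicCompletionIntegers K` to `𝒪[K_v]` along the identity of `K_v`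
(`hasGoodReduction_map_iff`; unit discriminant ⟸ elliptic reduction, `hasGoodReduction_iff_isElliptic_reduction`).
[cite: SilvermanAEC2009, VII.1 Prop. 1.3 and VII.5 Prop. 5.1 (a)] -/
theorem exists_integer_model_of_hasGoodReductionAt (hv : W.HasGoodReductionAt v) :
    ∃ (M : WeierstrassCurve 𝒪[v.adicCompletion K]) (C : VariableChange (v.adicCompletion K)),
      IsUnit M.Δ ∧ M.baseChange (v.adicCompletion K) = C • W.baseChange (v.adicCompletion K) := by
  obtain ⟨C, hC⟩ : ∃ C : VariableChange (v.adicCompletion K),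
      W.localMinimalModel v = C • W.baseChange (v.adicCompletion K) := ⟨_, rfl⟩
  have he := mem_range_algebraMap_valuationInteger_iff (K := K) v
  have hgood : ((W.localMinimalModel v).map
      ((RingEquiv.refl (v.adicCompletion K)) : v.adicCompletion K →+* v.adicCompletion K)).HasGoodReduction
        𝒪[v.adicCompletion K] :=
    (hasGoodReduction_map_iff (RingEquiv.refl (v.adicCompletion K)) he (W.localMinimalModel v)).mpr hv
  rw [RingEquiv.coe_ringHom_refl, WeierstrassCurve.map_id] at hgood
  haveI := hgood
  refine ⟨(W.localMinimalModel v).integralModel 𝒪[v.adicCompletion K], C, ?_, ?_⟩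
  · have h := ((WeierstrassCurve.hasGoodReduction_iff_isElliptic_reduction 𝒪[v.adicCompletion K]).mp hgood).isUnit
    change IsUnit (((W.localMinimalModel v).integralModel 𝒪[v.adicCompletion K]).map
      (IsLocalRing.residue 𝒪[v.adicCompletion K])).Δ at h
    rw [WeierstrassCurve.map_Δ] at h
    exact (isUnit_map_iff (IsLocalRing.residue 𝒪[v.adicCompletion K]) _).mp h
  · rw [WeierstrassCurve.baseChange_integralModel_eq, hC]

/-- **Kramer–Tunnell Lemma 6.1 (type `I₀`) / Mazur's norm theorem at a place of GOOD reduction, in the point currency of `W ⊗ K_v`:**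
for the unramified quadratic `K' ⊆ K̄_v` (`K' ≤ maxUnramified`, `[K' : K_v] = 2`, `σ ≠ 1`), every `σ`-fixed `K'`-point of `W` is a
norm `Q + σQ` — `fixedSubgroup ≤ normSubgroup` (relative index `1` for the unit-discriminant model of
`exists_integer_model_of_hasGoodReductionAt`, transported to `W ⊗ K_v` by `Kramer1981.relIndex_norm_fixed_smul`).
[cite: KramerTunnell1982, §6 Lemma 6.1 (p. 327), type I₀] [cite: MazurRubin2010, proof of Lemma 2.10 (v) («δ_v(E, F/K) = 0 by [Maz, Cor. 4.4]»)] -/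
theorem fixedSubgroup_le_normSubgroup_of_hasGoodReductionAt (hv : W.HasGoodReductionAt v)
    {K' : IntermediateField (v.adicCompletion K) (AlgebraicClosure (v.adicCompletion K))}
    (hK' : K' ≤ maxUnramified (v.adicCompletion K)) (h2 : Module.finrank (v.adicCompletion K) K' = 2)
    {σ : K' ≃ₐ[v.adicCompletion K] K'} (hσ : σ ≠ 1) :
    fixedSubgroup (W.baseChange (v.adicCompletion K)) K' σ ≤ normSubgroup (W.baseChange (v.adicCompletion K)) K' σ := by
  obtain ⟨M, C, hΔ, hM⟩ := exists_integer_model_of_hasGoodReductionAt W v hv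
  have h1 := relIndex_normSubgroup_fixedSubgroup_eq_one_of_isUnit_Δ M hΔ hK' h2 hσ
  rw [hM, Kramer1981.relIndex_norm_fixed_smul] at h1
  exact AddSubgroup.relIndex_eq_one.mp h1

end GoodNorm

/-! ## §90 The unramified quadratic field `K' = K_v(ι√d)` and the engine's `hnorm` -/

section Field

variable {K : Type} [Field K] [NumberField K] (W : WeierstrassCurve K) (v : HeightOneSpectrum (𝓞 K)) {d : K}

omit W in
/-- `(ι√d)² = d` in `K̄_v` (through `K → K_v → K̄_v`). [folklore] -/
theorem closureEmb_geomSqrt_sq_eq_algebraMap :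
    closureEmb (K := K) (v.adicCompletion K) (geomSqrt d) ^ 2 =
      algebraMap (v.adicCompletion K) (AlgebraicClosure (v.adicCompletion K)) (algebraMap K (v.adicCompletion K) d) := by
  rw [← map_pow, geomSqrt_sq, AlgHom.commutes, ← IsScalarTower.algebraMap_apply]

omit W in
/-- **`[K_v(ι√d) : K_v] = 2` when `d ∉ K_v²`** (`X² − d` is irreducible, Mathlib `X_pow_sub_C_irreducible_of_prime`). [folklore] -/
theorem finrank_adjoin_closureEmb_geomSqrt_eq_two
    (hd : ∀ s : v.adicCompletion K, s ^ 2 ≠ algebraMap K (v.adicCompletion K) d) :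
    Module.finrank (v.adicCompletion K)
      (IntermediateField.adjoin (v.adicCompletion K) {closureEmb (K := K) (v.adicCompletion K) (geomSqrt d)}) = 2 := by
  have hirr : Irreducible (X ^ 2 - C (algebraMap K (v.adicCompletion K) d) : (v.adicCompletion K)[X]) :=
    X_pow_sub_C_irreducible_of_prime Nat.prime_two hd
  have hint := isIntegral_closureEmb_geomSqrt (K := K) (d := d) (v.adicCompletion K)
  have hmin : minpoly (v.adicCompletion K) (closureEmb (K := K) (v.adicCompletion K) (geomSqrt d)) =
      X ^ 2 - C (algebraMap K (v.adicCompletion K) d) := by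
    refine (minpoly.eq_of_irreducible_of_monic hirr ?_ (monic_X_pow_sub_C _ two_ne_zero)).symm
    simp [closureEmb_geomSqrt_sq_eq_algebraMap v]
  rw [IntermediateField.adjoin.finrank hint, hmin, natDegree_X_pow_sub_C]

omit W in
/-- `K_v(ι√d) ⊆ K_v^{nr}` as soon as `ι√d ∈ K_v^{nr}` (e.g. `v ∣ 2`, `d ≡ 5 (mod 8)`: file 36's
`closureEmb_geomSqrt_mem_maxUnramified_of_emod_eight_eq_five`; `v ∤ 2d`: a unit square root is unramified). [folklore] -/
theorem adjoin_closureEmb_geomSqrt_le_maxUnramified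
    (hα : closureEmb (K := K) (v.adicCompletion K) (geomSqrt d) ∈ maxUnramified (v.adicCompletion K)) :
    IntermediateField.adjoin (v.adicCompletion K) {closureEmb (K := K) (v.adicCompletion K) (geomSqrt d)} ≤
      maxUnramified (v.adicCompletion K) :=
  IntermediateField.adjoin_le_iff.mpr (Set.singleton_subset_iff.mpr hα)

omit W in
/-- The generator of `K_v(ι√d)` squares to `d`. [folklore] -/
theorem adjoinSimple_gen_sq :
    (IntermediateField.AdjoinSimple.gen (v.adicCompletion K) (closureEmb (K := K) (v.adicCompletion K) (geomSqrt d))) ^ 2 =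
      algebraMap (v.adicCompletion K) _ (algebraMap K (v.adicCompletion K) d) := by
  apply Subtype.ext
  rw [SubmonoidClass.coe_pow, IntermediateField.AdjoinSimple.coe_gen, closureEmb_geomSqrt_sq_eq_algebraMap v]
  rfl

omit W in
/-- The generator of `K_v(ι√d)` is not in `K_v` when `d ∉ K_v²`. [folklore] -/
theorem adjoinSimple_gen_not_mem_range
    (hd : ∀ s : v.adicCompletion K, s ^ 2 ≠ algebraMap K (v.adicCompletion K) d) :
    IntermediateField.AdjoinSimple.gen (v.adicCompletion K) (closureEmb (K := K) (v.adicCompletion K) (geomSqrt d)) ∉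
      Set.range (algebraMap (v.adicCompletion K)
        (IntermediateField.adjoin (v.adicCompletion K) {closureEmb (K := K) (v.adicCompletion K) (geomSqrt d)})) := by
  rintro ⟨a, ha⟩
  apply hd a
  have h : algebraMap (v.adicCompletion K) (AlgebraicClosure (v.adicCompletion K)) a =
      closureEmb (K := K) (v.adicCompletion K) (geomSqrt d) := by
    rw [← IntermediateField.AdjoinSimple.coe_gen (v.adicCompletion K) (closureEmb (K := K) (v.adicCompletion K) (geomSqrt d)),
      ← ha]
    rfl
  apply (algebraMap (v.adicCompletion K) (AlgebraicClosure (v.adicCompletion K))).injective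
  rw [map_pow, h, closureEmb_geomSqrt_sq_eq_algebraMap v]

omit W in
/-- **Some `τ₀ ∈ Γ_{K_v}` flips `ι√d`** when `d ∉ K_v²` (lift the conjugation of the quadratic field `K_v(ι√d)`; tree
`exists_smul_geomSqrt_eq_neg`, and `ι√d = ±√(d_{K_v})`). [folklore] -/
theorem exists_flip_closureEmb_geomSqrt
    (hd : ∀ s : v.adicCompletion K, s ^ 2 ≠ algebraMap K (v.adicCompletion K) d) :
    ∃ τ₀ : absoluteGaloisGroup (v.adicCompletion K),
      (show AlgebraicClosure (v.adicCompletion K) ≃ₐ[v.adicCompletion K] AlgebraicClosure (v.adicCompletion K) from τ₀)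
          (closureEmb (K := K) (v.adicCompletion K) (geomSqrt d)) =
        -closureEmb (K := K) (v.adicCompletion K) (geomSqrt d) := by
  have hint := isIntegral_closureEmb_geomSqrt (K := K) (d := d) (v.adicCompletion K)
  haveI : FiniteDimensional (v.adicCompletion K)
      (IntermediateField.adjoin (v.adicCompletion K) {closureEmb (K := K) (v.adicCompletion K) (geomSqrt d)}) :=
    IntermediateField.adjoin.finiteDimensional hint
  obtain ⟨τ₀, hτ₀⟩ := exists_smul_geomSqrt_eq_neg (finrank_adjoin_closureEmb_geomSqrt_eq_two v hd)
    (adjoinSimple_gen_not_mem_range v hd) (adjoinSimple_gen_sq v)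
  refine ⟨τ₀, ?_⟩
  have hsq : closureEmb (K := K) (v.adicCompletion K) (geomSqrt d) ^ 2 =
      geomSqrt (algebraMap K (v.adicCompletion K) d) ^ 2 := by
    rw [closureEmb_geomSqrt_sq_eq_algebraMap v, geomSqrt_sq]
  change τ₀ • closureEmb (K := K) (v.adicCompletion K) (geomSqrt d) = _
  rcases sq_eq_sq_iff_eq_or_eq_neg.mp hsq with h | h
  · rw [h, hτ₀]
  · rw [h, smul_neg, hτ₀, neg_neg]

/-- **THE ENGINE'S `hnorm` AT A PLACE OF GOOD REDUCTION UNRAMIFIED IN `K(√d)`**: `W` good at `v`, `ι√d ∈ K_v^{nr}`, `d ∉ K_v²`,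
`τ₀ ∈ Γ_{K_v}` flipping `ι√d` ⟹ every `Γ_{K_v}`-fixed point of `W(K̄_v)` is `Q + τ₀Q` with `Q` fixed by the index-`2` subgroup
fixing `ι√d` (Mazur's norm theorem `E_N(K_v) = E(K_v)`: §89 + file 37). [cite: MazurRubin2010, proof of Lemma 2.10 (v)]
[cite: KramerTunnell1982, §6 Lemma 6.1 (p. 327), type I₀] -/
theorem forall_exists_norm_of_hasGoodReductionAt_of_mem_maxUnramified (hv : W.HasGoodReductionAt v)
    (hα : closureEmb (K := K) (v.adicCompletion K) (geomSqrt d) ∈ maxUnramified (v.adicCompletion K))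
    (hd : ∀ s : v.adicCompletion K, s ^ 2 ≠ algebraMap K (v.adicCompletion K) d)
    {τ₀ : absoluteGaloisGroup (v.adicCompletion K)}
    (hτ₀ : (show AlgebraicClosure (v.adicCompletion K) ≃ₐ[v.adicCompletion K] AlgebraicClosure (v.adicCompletion K) from τ₀)
        (closureEmb (K := K) (v.adicCompletion K) (geomSqrt d)) = -closureEmb (K := K) (v.adicCompletion K) (geomSqrt d)) :
    ∀ P ∈ MulAction.fixedPoints (absoluteGaloisGroup (v.adicCompletion K)) (localPoints W (v.adicCompletion K)),
      ∃ Q : localPoints W (v.adicCompletion K),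
        (∀ g : absoluteGaloisGroup (v.adicCompletion K),
          (show AlgebraicClosure (v.adicCompletion K) ≃ₐ[v.adicCompletion K] AlgebraicClosure (v.adicCompletion K) from g)
              (closureEmb (K := K) (v.adicCompletion K) (geomSqrt d)) =
              closureEmb (K := K) (v.adicCompletion K) (geomSqrt d) →
            g • Q = Q) ∧ Q + τ₀ • Q = P := by
  haveI : CharZero (v.adicCompletion K) := charZero_of_injective_algebraMap (algebraMap K _).injective
  have hint := isIntegral_closureEmb_geomSqrt (K := K) (d := d) (v.adicCompletion K)
  have h2 := finrank_adjoin_closureEmb_geomSqrt_eq_two v hd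
  haveI : Algebra.IsQuadraticExtension (v.adicCompletion K)
      (IntermediateField.adjoin (v.adicCompletion K) {closureEmb (K := K) (v.adicCompletion K) (geomSqrt d)}) :=
    { finrank_eq_two' := h2 }
  -- `σ := τ₀|_{K'}`
  set σ := (show AlgebraicClosure (v.adicCompletion K) ≃ₐ[v.adicCompletion K] AlgebraicClosure (v.adicCompletion K)
    from τ₀).restrictNormal
      (IntermediateField.adjoin (v.adicCompletion K) {closureEmb (K := K) (v.adicCompletion K) (geomSqrt d)}) with hσdef
  have hσ : ((σ (IntermediateField.AdjoinSimple.gen (v.adicCompletion K)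
      (closureEmb (K := K) (v.adicCompletion K) (geomSqrt d))) :
        IntermediateField.adjoin (v.adicCompletion K) {closureEmb (K := K) (v.adicCompletion K) (geomSqrt d)}) :
          AlgebraicClosure (v.adicCompletion K)) = -closureEmb (K := K) (v.adicCompletion K) (geomSqrt d) := by
    have h := AlgEquiv.restrictNormal_commutes
      (show AlgebraicClosure (v.adicCompletion K) ≃ₐ[v.adicCompletion K] AlgebraicClosure (v.adicCompletion K) from τ₀)
      (IntermediateField.adjoin (v.adicCompletion K) {closureEmb (K := K) (v.adicCompletion K) (geomSqrt d)})
      (IntermediateField.AdjoinSimple.gen (v.adicCompletion K) (closureEmb (K := K) (v.adicCompletion K) (geomSqrt d)))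
    rw [← hσdef] at h
    change ((σ _ : IntermediateField.adjoin (v.adicCompletion K) {closureEmb (K := K) (v.adicCompletion K) (geomSqrt d)}) :
      AlgebraicClosure (v.adicCompletion K)) = (show AlgebraicClosure (v.adicCompletion K) ≃ₐ[v.adicCompletion K]
        AlgebraicClosure (v.adicCompletion K) from τ₀) (closureEmb (K := K) (v.adicCompletion K) (geomSqrt d)) at h
    rw [h, hτ₀]
  have hα0 : closureEmb (K := K) (v.adicCompletion K) (geomSqrt d) ≠ 0 := by
    intro h0
    apply hd 0
    have h := closureEmb_geomSqrt_sq_eq_algebraMap (K := K) (d := d) v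
    rw [h0, zero_pow two_ne_zero, eq_comm, map_eq_zero] at h
    rw [h, zero_pow two_ne_zero]
  have hσ1 : σ ≠ 1 := by
    intro h1
    rw [h1, AlgEquiv.one_apply, IntermediateField.AdjoinSimple.coe_gen, eq_neg_iff_add_eq_zero, ← two_mul,
      mul_eq_zero] at hσ
    exact hσ.elim (fun h ↦ two_ne_zero h) hα0
  have hle := fixedSubgroup_le_normSubgroup_of_hasGoodReductionAt W v hv
    (adjoin_closureEmb_geomSqrt_le_maxUnramified v hα) h2 hσ1
  exact forall_exists_norm_of_fixedSubgroup_le_normSubgroup W (v.adicCompletion K) σ hσ hle hτ₀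

end Field

end Summit.BirchSwinnertonDyer.BirchSwinnertonDyer.Theorems.GenusKolyArch

end
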